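import Literature.Geometry.Riemannian.BakryEmeryHeatFlow
import Literature.Geometry.Lorentzian.CoordFormCauchySchwarz
import HarnessLib

/-!
# Li–Wang 2020, towards Thm. 1.1 (all-scales LSI of a shrinker): the pointwise layer —
# the trace inequality `(Δφ)² ≤ n |Hess φ|²` and the DIMENSIONAL dissipation inequality of the
# Fisher information along the weighted heat flow

First proof file towards `LiWang2020_shrinkerLSI_allScales_holds`
(`ShrinkerEntropyAllScales.lean`; Y. Li, B. Wang, *Heat kernel on Ricci shrinkers*, Calc. Var. PDE 59
(2020) = arXiv:1901.05691, Thm. 1.1 / Prop. 5.9). Li–Wang prove the monotonicity of `μ(g, τ)` in `τ`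
(their Thm. 4.3, Cor. 4.7, Lemma 5.10) by Perelman's entropy formula along the conjugate heat flow of
the shrinker space-time, pulled back to the static shrinker by the self-similar diffeomorphisms
(their (5.x) = (eqn PK08_6)); in the static frame this is a computation along the weighted heat flow
`∂ₛρ = Δ_f ρ` in which — in contrast with the Bakry–Émery argument (their Thm. 5.4, (BE4)) — the
Hessian term of the Bochner formula is KEPT through the trace inequality `|Hess φ|² ≥ (Δ_g φ)²/n`.
This file supplies that pointwise input, in the vocabulary of `BakryEmeryHeatFlow.lean`:

* `MetricCoord.mtrAt_sq_le_finrank_mul_normSqAt` — `(tr_G T)² ≤ n |T|²_G` at a positive definite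
  point (orthonormal frame + Cauchy–Schwarz); `MetricCoord.lapAt_sq_le` — `(Δf)² ≤ n |Hess f|²`;
* `fisher_pointwise_le_dim` — for `f` smooth on `M × S` solving `∂ₜf = Lf − |∇f|²`,
  `L = Δ_g − g⁻¹(dV, d·)`, under `Ric + Hess V ≥ K g`:
  `∂ₜ|∇f|² ≤ L|∇f|² − 2 g⁻¹(df, d|∇f|²) − 2K|∇f|² − (2/n)(Δ_g f)²` (`n = dim M`; the refinement of
  `fisher_pointwise_le` by the trace inequality — Li–Wang's (BE4) with `|Hess ρ − dρ⊗dρ/ρ|²/ρ =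
  ρ|Hess log ρ|² ≥ ρ (Δ log ρ)²/n`).

Theorems only; no definitions, no named facts (D-0026).

## References

* [LiWang2020] Y. Li, B. Wang, Calc. Var. PDE 59 (2020) no. 194 (arXiv:1901.05691): Thm. 5.4 and its
  proof, (BE4) (arXiv pp. 18–19); Lemma 5.10 (p. 20). READ (held text paper:arxiv-1901.05691).
* [CarrilloNi2009] J. A. Carrillo, L. Ni, Comm. Anal. Geom. 17 (2009), §3 (p. 8).
* [Topping2006] P. Topping, *Lectures on the Ricci flow* (2006), proof of Prop. 8.2.6 (Bochner).
-/

noncomputable section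

open Set Filter ContinuousLinearMap Module
open scoped Topology ContDiff

namespace Literature.Geometry.Lorentzian

namespace MetricCoord

variable {E : Type*} [NormedAddCommGroup E] [NormedSpace ℝ E] [FiniteDimensional ℝ E]
  {G : E → E →L[ℝ] E →L[ℝ] ℝ} {x : E}

/-- **`(tr_G T)² ≤ n |T|²_G`** for a bilinear form at a point where `G x` is symmetric positive
definite (`n = dim E`): in a `G x`-orthonormal frame `tr T = Σᵢ Tᵢᵢ`, `|T|² = Σᵢⱼ Tᵢⱼ²`, and
`(Σᵢ Tᵢᵢ)² ≤ n Σᵢ Tᵢᵢ²` (Cauchy–Schwarz). [folklore] -/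
theorem mtrAt_sq_le_finrank_mul_normSqAt (hi : (G x).IsInvertible) (hs : ∀ v w, G x v w = G x w v)
    (hpos : ∀ v, v ≠ 0 → 0 < G x v v) (T : E →L[ℝ] E →L[ℝ] ℝ) :
    (mtrAt G x T) ^ 2 ≤ (finrank ℝ E : ℝ) * normSqAt G x T := by
  classical
  obtain ⟨e, he⟩ := exists_orthonormal_basis hs hpos
  rw [mtrAt_eq_sum_frame e he hi, normSqAt_eq_sum_frame e he hi hs]
  calc (∑ i, T (e i) (e i)) ^ 2
      ≤ (Fintype.card (Fin (finrank ℝ E)) : ℝ) * ∑ i, T (e i) (e i) ^ 2 := by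
        have h := sq_sum_le_card_mul_sum_sq (s := Finset.univ) (f := fun i ↦ T (e i) (e i))
        simpa only [Finset.card_univ] using h
    _ ≤ (finrank ℝ E : ℝ) * ∑ i, ∑ j, T (e i) (e j) ^ 2 := by
        rw [Fintype.card_fin]
        refine mul_le_mul_of_nonneg_left (Finset.sum_le_sum fun i _ ↦ ?_) (Nat.cast_nonneg _)
        exact Finset.single_le_sum (f := fun j ↦ T (e i) (e j) ^ 2) (fun j _ ↦ sq_nonneg _)
          (Finset.mem_univ i)

/-- **`(Δf)² ≤ n |Hess f|²`** in coordinates at a positive definite point (`Δ = tr_G Hess`).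
[cite: LiWang2020, proof of Thm. 5.4, (BE4) (arXiv p. 19)] -/
theorem lapAt_sq_le (hi : (G x).IsInvertible) (hs : ∀ v w, G x v w = G x w v)
    (hpos : ∀ v, v ≠ 0 → 0 < G x v v) (f : E → ℝ) :
    (lapAt G f x) ^ 2 ≤ (finrank ℝ E : ℝ) * normSqAt G x (hessAt G f x) :=
  mtrAt_sq_le_finrank_mul_normSqAt hi hs hpos (hessAt G f x)

end MetricCoord

end Literature.Geometry.Lorentzian

/-! ### The dimensional dissipation inequality on the manifold -/

open Bundle Set Function Filter
open scoped Manifold ContDiff Topology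

namespace Literature.Geometry.Riemannian

open Lorentzian Lorentzian.PseudoRiemannianMetric

section Pointwise

variable {E : Type*} [NormedAddCommGroup E] [NormedSpace ℝ E] [FiniteDimensional ℝ E]
  {H : Type*} [TopologicalSpace H] {I : ModelWithCorners ℝ E H} [I.Boundaryless]
  {M : Type*} [TopologicalSpace M] [ChartedSpace H M] [IsManifold I ∞ M]
  (g : PseudoRiemannianMetric I ∞ E (TangentSpace I : M → Type _)) [g.HasLeviCivita]

/-- `(2/n)(n a) ≤ 2a` for `a ≥ 0` and a natural number `n` (equality for `n ≠ 0`, and `0 ≤ 2a`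
for `n = 0`, where `2/n` is the junk value `0`). [folklore] -/
theorem two_div_mul_mul_le {n : ℕ} {a : ℝ} (ha : 0 ≤ a) :
    2 / (n : ℝ) * ((n : ℝ) * a) ≤ 2 * a := by
  rcases Nat.eq_zero_or_pos n with hn | hn
  · subst hn; simp; linarith
  · have hn' : (n : ℝ) ≠ 0 := by exact_mod_cast hn.ne'
    rw [show 2 / (n : ℝ) * ((n : ℝ) * a) = 2 * a by field_simp]

/-- **The DIMENSIONAL pointwise dissipation inequality along the weighted heat flow** (the
refinement of `fisher_pointwise_le` in which the Hessian term of the Bochner formula is kept through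
`|Hess f|² ≥ (Δ_g f)²/n`; Li–Wang 2020, proof of Thm. 5.4, (BE4), combined with the trace
inequality as in Perelman's entropy formula). Let `g` be Riemannian with `Ric + Hess V ≥ K g`
(`V ∈ C^∞`), and `f : ℝ → M → ℝ` `C^∞` on `M × S` (`S` with unique derivatives,
`S ⊆ closure (interior S)`) solving at each time of `S` `∂ₜf = Lf − |∇f|²`, `L = Δ_g − g⁻¹(dV, d·)`
(the equation of `f = −log u`, `∂ₜu = Lu`). Then at every `x`, `t ∈ S`, with `n = dim M`:

  `∂ₜ|∇f|² ≤ L|∇f|² − 2 g⁻¹(df, d|∇f|²) − 2K|∇f|² − (2/n)(Δ_g f)²`.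

Proof: the coordinate identity `MetricCoord.IsMetricOn.fisher_identity` read in the chart at `x`
(bridges of `BakryEmeryHeatFlow.lean`), `Ric_V(∇f,∇f) ≥ K|∇f|²`, and `|Hess f|² ≥ (Δf)²/n`
(`MetricCoord.lapAt_sq_le`, the chart metric being positive definite, `chartPullback_pos`).
[cite: LiWang2020, proof of Thm. 5.4, (BE4) (arXiv p. 19) and Lemma 5.10 (p. 20)]
[cite: CarrilloNi2009, §3 (p. 8)] -/
theorem fisher_pointwise_le_dim (hR : g.IsRiemannian) {V : M → ℝ} {K : ℝ}
    (hV : ContMDiff I 𝓘(ℝ, ℝ) ∞ V)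
    (hRic : ∀ (y : M) (X : TangentSpace I y), K * g.val y X X ≤ g.ricci y X X + g.hessian V y X X)
    {f : ℝ → M → ℝ} {S : Set ℝ} (hS : UniqueDiffOn ℝ S) (hS' : S ⊆ closure (interior S))
    (hf : ContMDiffOn (I.prod 𝓘(ℝ, ℝ)) 𝓘(ℝ, ℝ) ∞ (fun p : M × ℝ ↦ f p.2 p.1) (univ ×ˢ S))
    (heq : ∀ t ∈ S, ∀ y : M, derivWithin (fun s ↦ f s y) S t =
      g.dalembertian (f t) y
        - g.innerDual y (mvfderiv I V y : TangentSpace I y →ₗ[ℝ] ℝ)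
            (mvfderiv I (f t) y : TangentSpace I y →ₗ[ℝ] ℝ)
        - g.gradSq (f t) y)
    (x : M) {t : ℝ} (ht : t ∈ S) :
    derivWithin (fun s ↦ g.gradSq (f s) x) S t ≤
      (g.dalembertian (g.gradSq (f t)) x
        - g.innerDual x (mvfderiv I V x : TangentSpace I x →ₗ[ℝ] ℝ)
            (mvfderiv I (g.gradSq (f t)) x : TangentSpace I x →ₗ[ℝ] ℝ))
      - 2 * g.innerDual x (mvfderiv I (f t) x : TangentSpace I x →ₗ[ℝ] ℝ)
            (mvfderiv I (g.gradSq (f t)) x : TangentSpace I x →ₗ[ℝ] ℝ)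
      - 2 * K * g.gradSq (f t) x
      - 2 / (finrank ℝ E : ℝ) * (g.dalembertian (f t) x) ^ 2 := by
  -- the chart at `x`, the components `G`, the representatives `F̂`, `V̂`
  set G := chartRep I (fun _ ↦ g) x 0 with hGdef
  have hGrep := val_chartPullback_eq_chartRep (fun _ : ℝ ↦ g) x 0
  have hGm : MetricCoord.IsMetricOn G (extChartAt I x).target :=
    Lorentzian.OpensChart.isMetricOn_repr hGrep
  set Fh : ℝ → E → ℝ := fun s z ↦ f s ((extChartAt I x).symm z) with hFhdef
  set Vh : E → ℝ := V ∘ (extChartAt I x).symm with hVhdef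
  have hu₀ : extChartAt I x x ∈ (extChartAt I x).target := mem_extChartAt_target x
  set u₀ : chartTarget I x := ⟨extChartAt I x x, hu₀⟩ with hu₀def
  have hΦu₀ : chartInv I x u₀ = x := extChartAt_to_inv x
  -- smoothness of the slices and representatives
  have hslice : ∀ s ∈ S, ContMDiff I 𝓘(ℝ, ℝ) ∞ (f s) := fun s hs ↦
    hf.comp_contMDiff (contMDiff_id.prodMk contMDiff_const) fun y ↦ ⟨mem_univ _, hs⟩
  have hFh : ContDiffOn ℝ ∞ (fun p : E × ℝ ↦ Fh p.2 p.1) ((extChartAt I x).target ×ˢ S) :=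
    contDiffOn_time_chart hf x
  have hVh : ContDiffOn ℝ ∞ Vh (extChartAt I x).target := by
    rw [hVhdef, ← contMDiffOn_iff_contDiffOn]
    exact hV.comp_contMDiffOn (contMDiffOn_extChartAt_symm x)
  -- the equation read in the chart
  have heq' : ∀ z ∈ (extChartAt I x).target, MetricCoord.tDerivFun Fh S t z =
      MetricCoord.lapAt G (Fh t) z - fderiv ℝ (Fh t) z (MetricCoord.sharpAt G z (fderiv ℝ Vh z))
        - MetricCoord.gradSqAt G (Fh t) z := by
    intro z hz
    set u : chartTarget I x := ⟨z, hz⟩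
    have hy := heq t ht (chartInv I x u)
    have hft2 : ContMDiffAt I 𝓘(ℝ, ℝ) 2 (f t) (chartInv I x u) :=
      ((hslice t ht).of_le (WithTop.coe_le_coe.mpr le_top)).contMDiffAt
    have hftd : MDifferentiableAt I 𝓘(ℝ, ℝ) (f t) (chartInv I x u) :=
      (hslice t ht).mdifferentiableAt (by simp)
    have hVd : MDifferentiableAt I 𝓘(ℝ, ℝ) V (chartInv I x u) := hV.mdifferentiableAt (by simp)
    rw [dalembertian_chartInv_eq g x u hft2, innerDual_chartInv_eq g x u hVd hftd,
      gradSq_chartInv_eq g x u hftd] at hy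
    rw [MetricCoord.tDerivFun, show (fun s ↦ Fh s z) = fun s ↦ f s (chartInv I x u) from rfl, hy,
      MetricCoord.apply_sharpAt_comm (hGm.isInvertible z hz) (hGm.symm z hz)]
    rfl
  -- the coordinate identity at `(φ x, t)`
  have key := hGm.fisher_identity hS hS' hFh hVh hu₀ ht heq'
  -- transport of each term back to `x`
  have hft : ContMDiff I 𝓘(ℝ, ℝ) ∞ (f t) := hslice t ht
  have hftd : MDifferentiableAt I 𝓘(ℝ, ℝ) (f t) (chartInv I x u₀) := hft.mdifferentiableAt (by simp)
  have hVd : MDifferentiableAt I 𝓘(ℝ, ℝ) V (chartInv I x u₀) := hV.mdifferentiableAt (by simp)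
  have hQ : ContMDiff I 𝓘(ℝ, ℝ) ∞ (g.gradSq (f t)) := contMDiff_gradSq g hft
  have hQ2 : ContMDiffAt I 𝓘(ℝ, ℝ) 2 (g.gradSq (f t)) (chartInv I x u₀) :=
    (hQ.of_le (WithTop.coe_le_coe.mpr le_top)).contMDiffAt
  have hQd : MDifferentiableAt I 𝓘(ℝ, ℝ) (g.gradSq (f t)) (chartInv I x u₀) :=
    hQ.mdifferentiableAt (by simp)
  -- (a) `|∇f_s|²(x) = gradSqAt G (F̂ s) (φ x)` for all `s ∈ S`
  have hgrad : ∀ s ∈ S, g.gradSq (f s) x = MetricCoord.gradSqAt G (Fh s) (extChartAt I x x) := by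
    intro s hs
    have h := gradSq_chartInv_eq g x u₀ (F := f s)
      ((hslice s hs).mdifferentiableAt (by simp))
    rw [hΦu₀] at h
    exact h
  -- (b) the representative of `|∇f_t|²` agrees with `gradSqAt G (F̂ t)` on the target
  have hQrep : (g.gradSq (f t) ∘ (extChartAt I x).symm) =ᶠ[𝓝 (extChartAt I x x)]
      MetricCoord.gradSqAt G (Fh t) := by
    filter_upwards [(isOpen_extChartAt_target x).mem_nhds hu₀] with z hz
    exact gradSq_chartInv_eq g x ⟨z, hz⟩ (F := f t) (hft.mdifferentiableAt (by simp))
  -- (c) the Laplacians of `|∇f|²` and of `f`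
  have hlap : g.dalembertian (g.gradSq (f t)) x =
      MetricCoord.lapAt G (MetricCoord.gradSqAt G (Fh t)) (extChartAt I x x) := by
    have h := dalembertian_chartInv_eq g x u₀ hQ2
    rw [hΦu₀] at h
    rw [h]
    exact MetricCoord.lapAt_congr_of_eventuallyEq G hQrep
  have hft2 : ContMDiffAt I 𝓘(ℝ, ℝ) 2 (f t) (chartInv I x u₀) :=
    (hft.of_le (WithTop.coe_le_coe.mpr le_top)).contMDiffAt
  have hlapf : g.dalembertian (f t) x = MetricCoord.lapAt G (Fh t) (extChartAt I x x) := by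
    have h := dalembertian_chartInv_eq g x u₀ hft2
    rw [hΦu₀] at h
    exact h
  -- (d) the two first-order terms
  have hIV : g.innerDual x (mvfderiv I V x : TangentSpace I x →ₗ[ℝ] ℝ)
      (mvfderiv I (g.gradSq (f t)) x : TangentSpace I x →ₗ[ℝ] ℝ) =
      fderiv ℝ (MetricCoord.gradSqAt G (Fh t)) (extChartAt I x x)
        (MetricCoord.sharpAt G (extChartAt I x x) (fderiv ℝ Vh (extChartAt I x x))) := by
    have h := innerDual_chartInv_eq g x u₀ hVd hQd
    rw [hΦu₀] at h
    rw [h, MetricCoord.apply_sharpAt_comm (hGm.isInvertible _ hu₀) (hGm.symm _ hu₀),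
      hQrep.fderiv_eq]
  have hIf : g.innerDual x (mvfderiv I (f t) x : TangentSpace I x →ₗ[ℝ] ℝ)
      (mvfderiv I (g.gradSq (f t)) x : TangentSpace I x →ₗ[ℝ] ℝ) =
      fderiv ℝ (MetricCoord.gradSqAt G (Fh t)) (extChartAt I x x)
        (MetricCoord.sharpAt G (extChartAt I x x) (fderiv ℝ (Fh t) (extChartAt I x x))) := by
    have h := innerDual_chartInv_eq g x u₀ hftd hQd
    rw [hΦu₀] at h
    rw [h, MetricCoord.apply_sharpAt_comm (hGm.isInvertible _ hu₀) (hGm.symm _ hu₀),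
      hQrep.fderiv_eq]
    rfl
  -- (e) the time derivative
  have hderiv : derivWithin (fun s ↦ g.gradSq (f s) x) S t =
      derivWithin (fun s ↦ MetricCoord.gradSqAt G (Fh s) (extChartAt I x x)) S t :=
    derivWithin_congr (fun s hs ↦ hgrad s hs) (hgrad t ht)
  -- (f) the signs of the right-hand side: `Ric_V ≥ K`, and `|Hess f|² ≥ (Δf)²/n`
  have hV2 : ContMDiffAt I 𝓘(ℝ, ℝ) 2 V (chartInv I x u₀) :=
    (hV.of_le (WithTop.coe_le_coe.mpr le_top)).contMDiffAt
  have hB := bakryEmery_chartInv_le g x u₀ hV2 (fun X ↦ hRic _ X)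
    (MetricCoord.sharpAt G (extChartAt I x x) (fderiv ℝ (Fh t) (extChartAt I x x)))
  have hGX : G (extChartAt I x x)
      (MetricCoord.sharpAt G (extChartAt I x x) (fderiv ℝ (Fh t) (extChartAt I x x)))
      (MetricCoord.sharpAt G (extChartAt I x x) (fderiv ℝ (Fh t) (extChartAt I x x))) =
      g.gradSq (f t) x := by
    rw [MetricCoord.apply_sharpAt_sharpAt (hGm.isInvertible _ hu₀), hgrad t ht]
    rfl
  -- positivity of the chart metric at `φ x`
  have hGpos : ∀ v : E, v ≠ 0 → 0 < G (extChartAt I x x) v v := by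
    intro v hv
    have h := chartPullback_pos g x u₀ (fun w hw ↦ hR _ w hw) v hv
    rw [hGrep u₀] at h
    exact h
  have hTr := MetricCoord.lapAt_sq_le (hGm.isInvertible _ hu₀) (hGm.symm _ hu₀) hGpos (Fh t)
  have hN : 0 ≤ MetricCoord.normSqAt G (extChartAt I x x)
      (MetricCoord.hessAt G (Fh t) (extChartAt I x x)) :=
    normSqAt_hessAt_chartRep_nonneg g hR x u₀ hft2
  have hdim : 2 / (finrank ℝ E : ℝ) * (g.dalembertian (f t) x) ^ 2 ≤
      2 * MetricCoord.normSqAt G (extChartAt I x x)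
        (MetricCoord.hessAt G (Fh t) (extChartAt I x x)) := by
    rw [hlapf]
    refine le_trans (mul_le_mul_of_nonneg_left hTr (by positivity)) ?_
    exact two_div_mul_mul_le hN
  rw [hderiv, hlap, hIV, hIf]
  have hB' : K * g.gradSq (f t) x ≤
      MetricCoord.ricAt G (extChartAt I x x)
          (MetricCoord.sharpAt G (extChartAt I x x) (fderiv ℝ (Fh t) (extChartAt I x x)))
          (MetricCoord.sharpAt G (extChartAt I x x) (fderiv ℝ (Fh t) (extChartAt I x x)))
        + MetricCoord.hessAt G Vh (extChartAt I x x)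
          (MetricCoord.sharpAt G (extChartAt I x x) (fderiv ℝ (Fh t) (extChartAt I x x)))
          (MetricCoord.sharpAt G (extChartAt I x x) (fderiv ℝ (Fh t) (extChartAt I x x))) := by
    rw [← hGX]
    exact hB
  linarith [key, hdim, hB']

end Pointwise

end Literature.Geometry.Riemannian

end
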